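import Mathlib.LinearAlgebra.Span.Basic
import Mathlib.Algebra.Module.Submodule.Map
import Mathlib.Algebra.Module.Submodule.Ker
import Mathlib.Algebra.Module.Submodule.Range
import Mathlib.Tactic.Abel
import HarnessLib

/-!
# Saturation devissage along a saturated filtration (cell `b2b-bsdres`, seat additive-p4 gen 36, line V62 — the lattice skeleton of Proposition D)

HONEST FRAMING (verbatim, cell `b2b-bsdres`): the goal of the cell is to DELETE the COMBINATION-SHAPED
residual classes for ALL analytic-rank `≤ 1` curves over `ℚ` — "full BSD formula for every rank `≤ 1`
curve in class `C`" assembled STRICTLY from published theorems — so that the rank-`≤ 1` remainder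
becomes exactly the CONSTRUCTION-SHAPED classes, which are TYPED (missing-input Props), NOT attempted;
this is not "finishing BSD". This file: TOOL theorems (pure module algebra; 0 defs, 0 facts, nothing
booked; X4 stays CONSTRUCTION-SHAPED; no mark moves).

## Why

The typed target T-V54 of the additive certificate ("two-prime old-space saturation at a non-Eisenstein
maximal ideal", memos V54/V56; `X4/TwoPrimeExactnessBridges.lean`) is, at a `p`-OLD `U_p`-nilpotent
maximal ideal `𝔪̃` of level `p²M`, a statement about a lattice `X` carrying a SATURATED filtration
`X¹ ≤ X` (the `p`-old part) with torsion-free quotient `X² = X/X¹` (the `p²`-new quotient block), and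
two "old" sublattices `O₁, O₂ ≤ X` (memo V60 §7.6, memo V62 §2). Saturation of `O = O₁ + O₂` in `X`
("no `r`-torsion in `X/O`", `r` = the residue characteristic) DEVISSES along the filtration. This file
proves the four elementary pieces used in memo V62, Proposition D, in the language of submodules of a
module over a commutative ring and a fixed scalar `r` (saturation = `r • x ∈ A → x ∈ A`):

* `smul_mem_imp_mem_of_filtration` (D1 (i)): if `X¹/(O ∩ X¹)` and `X/(O + X¹)` have no `r`-torsion,
  then `X/O` has no `r`-torsion.
* `inf_sup_eq_of_saturated_of_pow_torsion` (D1 (ii), "the gluing is automatic"): if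
  `(O₁ ∩ X¹) + (O₂ ∩ X¹)` is `r`-saturated in `X¹` and `((O₁ + O₂) ∩ X¹)/((O₁ ∩ X¹) + (O₂ ∩ X¹))` is
  `r`-power torsion (in the application: automatic, the old spaces being sub-sums over newform packets),
  then `(O₁ + O₂) ∩ X¹ = (O₁ ∩ X¹) + (O₂ ∩ X¹)`.
* `smul_mem_map_imp_of_ker_le` (used in D3, §3.2: pulling saturation back along `j : (Y²)^{nil} ↠ X¹`):
  saturation is transported along a surjective linear map whose kernel lies inside the submodule.
* `smul_mem_map_imp_of_idempotent` (used in D3, §3.2: the `U_p`-nilpotent idempotent `e`): if `S` is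
  `r`-saturated in `M` and stable under an idempotent endomorphism `e`, then `e(S)` is `r`-saturated in
  `e(M)`.

No number theory enters; the identification of the graded conditions with statements at the semistable
level `pM` (memo V62 §3) is NOT formalised here.

## References (context only; the proofs are elementary)

* A. Wiles, Ann. of Math. 141 (1995), §2 (Ihara's lemma at a prime dividing the level: the `p`-old part
  is saturated — the hypothesis "X¹ saturated" of the application). [cite: Wiles1995, §2]
* K. Ribet, Proc. ICM 1983 (1984), Thm. 4.1. [cite: Ribet1984ICM, Thm. 4.1]
-/

namespace Summit.BirchSwinnertonDyer.Rank1Residual.LevelLowering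

section Devissage

variable {R M N : Type*} [CommRing R] [AddCommGroup M] [Module R M] [AddCommGroup N] [Module R N]

/-- **D1 (i): saturation devisses along a filtration.** For submodules `X₁, O ≤ M` and a scalar `r`:
if `X₁/(O ⊓ X₁)` has no `r`-torsion (`x ∈ X₁`, `r • x ∈ O ⟹ x ∈ O`) and `M/(O ⊔ X₁)` has no
`r`-torsion, then `M/O` has no `r`-torsion. (Memo V62 Prop. D1 (i); the converse half
"`M/O` has no `r`-torsion ⟹ `X₁/(O ⊓ X₁)` has none" is the restriction of the hypothesis and needs no
lemma.) [cite: Wiles1995, §2] -/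
theorem smul_mem_imp_mem_of_filtration (r : R) (X₁ O : Submodule R M)
    (h₁ : ∀ x ∈ X₁, r • x ∈ O → x ∈ O)
    (h₂ : ∀ x : M, r • x ∈ O ⊔ X₁ → x ∈ O ⊔ X₁) :
    ∀ x : M, r • x ∈ O → x ∈ O := by
  intro x hx
  obtain ⟨o, ho, y, hy, hsum⟩ := Submodule.mem_sup.mp (h₂ x (Submodule.mem_sup_left hx))
  have hry : r • y ∈ O := by
    have e : r • y = r • x - r • o := by rw [← hsum, smul_add]; abel
    rw [e]
    exact O.sub_mem hx (O.smul_mem r ho)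
  rw [← hsum]
  exact O.add_mem ho (h₁ y hy hry)

/-- Iterating a one-step saturation hypothesis: if `x ∈ X₁`, `r • x ∈ P ⟹ x ∈ P` for all `x ∈ X₁`, then
`r ^ n • x ∈ P ⟹ x ∈ P` for `x ∈ X₁`. -/
theorem pow_smul_mem_imp_mem (r : R) (X₁ P : Submodule R M)
    (hsat : ∀ x ∈ X₁, r • x ∈ P → x ∈ P) :
    ∀ (n : ℕ) (x : M), x ∈ X₁ → r ^ n • x ∈ P → x ∈ P := by
  intro n
  induction n with
  | zero => intro x _ hx; simpa using hx
  | succ n ih =>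
      intro x hx hrx
      have hrx' : r ^ n • (r • x) ∈ P := by
        rw [← mul_smul, ← pow_succ]; exact hrx
      exact hsat x hx (ih (r • x) (X₁.smul_mem r hx) hrx')

/-- **D1 (ii): the gluing is automatic.** For submodules `O₁, O₂, X₁ ≤ M` and a scalar `r`: if
`(O₁ ⊓ X₁) ⊔ (O₂ ⊓ X₁)` is `r`-saturated in `X₁` and every element of `(O₁ ⊔ O₂) ⊓ X₁` has an
`r`-power multiple in `(O₁ ⊓ X₁) ⊔ (O₂ ⊓ X₁)` (in memo V62: automatic, because rationally the old
spaces are sub-sums over newform packets, hence distributive), then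
`(O₁ ⊔ O₂) ⊓ X₁ = (O₁ ⊓ X₁) ⊔ (O₂ ⊓ X₁)` — condition (c) of memo V60 §7.6 costs nothing.
[cite: Ribet1984ICM, Thm. 4.1] -/
theorem inf_sup_eq_of_saturated_of_pow_torsion (r : R) (O₁ O₂ X₁ : Submodule R M)
    (hsat : ∀ x ∈ X₁, r • x ∈ (O₁ ⊓ X₁) ⊔ (O₂ ⊓ X₁) → x ∈ (O₁ ⊓ X₁) ⊔ (O₂ ⊓ X₁))
    (htors : ∀ x ∈ (O₁ ⊔ O₂) ⊓ X₁, ∃ n : ℕ, r ^ n • x ∈ (O₁ ⊓ X₁) ⊔ (O₂ ⊓ X₁)) :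
    (O₁ ⊔ O₂) ⊓ X₁ = (O₁ ⊓ X₁) ⊔ (O₂ ⊓ X₁) := by
  apply le_antisymm
  · intro x hx
    obtain ⟨n, hn⟩ := htors x hx
    exact pow_smul_mem_imp_mem r X₁ _ hsat n x (Submodule.mem_inf.mp hx).2 hn
  · exact sup_le (inf_le_inf_right X₁ le_sup_left) (inf_le_inf_right X₁ le_sup_right)

/-- **Transport of saturation along a surjection with kernel inside the submodule** (memo V62 §3.2: the
`p`-degeneracy map `j : (Y²)^{nil} → X¹` is onto with kernel `κ(K₀)^{nil}` contained in both pulled-back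
old lattices). If `f : M →ₗ N` is surjective, `ker f ≤ S` and `S` is `r`-saturated in `M`, then `f(S)` is
`r`-saturated in `N`. [cite: Wiles1995, §2] -/
theorem smul_mem_map_imp_of_ker_le (r : R) (f : M →ₗ[R] N) (hf : Function.Surjective f)
    (S : Submodule R M) (hker : LinearMap.ker f ≤ S)
    (hsat : ∀ x : M, r • x ∈ S → x ∈ S) :
    ∀ y : N, r • y ∈ S.map f → y ∈ S.map f := by
  intro y hy
  obtain ⟨x, rfl⟩ := hf y
  obtain ⟨s, hs, hfs⟩ := Submodule.mem_map.mp hy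
  have hk : r • x - s ∈ LinearMap.ker f := by
    rw [LinearMap.mem_ker, map_sub, map_smul, hfs, sub_self]
  have hrx : r • x ∈ S := by
    have e : r • x = (r • x - s) + s := by abel
    rw [e]
    exact S.add_mem (hker hk) hs
  exact Submodule.mem_map_of_mem (hsat x hrx)

/-- **Saturation passes to the image of a stable submodule under an idempotent** (memo V62 §3.2: `e` =
the `U_p`-topologically-nilpotent idempotent on `Y²`, `S = O(Y)² + κ(K₀)` is `e`-stable, and
`S ∩ e(Y²) = e(S)`). If `e ∘ e = e`, `e(S) ≤ S` and `S` is `r`-saturated in `M`, then for every `y` in the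
range of `e`: `r • y ∈ e(S) ⟹ y ∈ e(S)`. -/
theorem smul_mem_map_imp_of_idempotent (r : R) (e : M →ₗ[R] M) (he : e ∘ₗ e = e)
    (S : Submodule R M) (hstab : S.map e ≤ S)
    (hsat : ∀ x : M, r • x ∈ S → x ∈ S) :
    ∀ y ∈ LinearMap.range e, r • y ∈ S.map e → y ∈ S.map e := by
  intro y hy hry
  obtain ⟨x, rfl⟩ := LinearMap.mem_range.mp hy
  have hfix : e (e x) = e x := by
    have := LinearMap.congr_fun he x
    simpa using this
  have h1 : r • e x ∈ S := hstab hry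
  have h2 : e x ∈ S := hsat (e x) h1
  rw [← hfix]
  exact Submodule.mem_map_of_mem h2

end Devissage

end Summit.BirchSwinnertonDyer.Rank1Residual.LevelLowering
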